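import Literature.AlgebraicGeometry.AbelianSchemes.AbelianSchemeDualTransport
import Literature.AlgebraicGeometry.AbelianSchemes.AbelianSchemePolarization
import Literature.AlgebraicGeometry.AbelianSchemes.AbelianSchemeOverRestrictPt
import Literature.AlgebraicGeometry.AbelianVarieties.PoincareSheafOfPrincipal
import Literature.AlgebraicGeometry.Modules.DetClassTensor
import Literature.AlgebraicGeometry.Modules.DetClassDual
import HarnessLib

/-!
# The unit hypothesis of the dual transport from a polarisation: `𝒫|_{A × {ε_Â}} ≅ 𝒪` when `λ̄ = Λ(𝒪(Θ))`
# — clause (ii) of [MFK94] Def. 7.3 along `𝟙` for POLARISED abelian schemes (sequel of ★ `AbelianSchemeDualTransport`)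

Topic `AlgebraicGeometry/AbelianSchemes`; namespace `Literature.AlgebraicGeometry.AbelianSchemes.AbelianSchemeOver.DualPair`.
Cell hodgecm-mathlib (D-0151), rung-0 ladder / M1PRIME-DAG **W3c (c-ii-H)**, sequel of ★ `AbelianSchemeDualTransport`
(`hatTransport`, `unitHatSlice`, `unitSection_comp_hatTransport`, `isMonHom_hatTransportOver`,
`hat_isBaseChangeVia_id_hatTransport` — whose unit hypotheses «`𝒫|_{A × {ε_Â}} ≅ 𝒪`» this file DISCHARGES from a
polarisation), over ★ D2p2 `AbelianSchemePolarization` (`IsLambdaOfAt`, `sliceAt`, `valueAt`), ★ `AbelianSchemeOverRestrictPt`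
(`restrictPt_one`), ★ `PoincareSheafOfPrincipal` (`nonempty_iso_unitModule_of_detClass_eq_one`), ★ `DetClassTensor` /
`DetClassDual` (determinant classes of `L ⊗ L^∨`).  THEOREMS ONLY (no def, no structure, no named fact, no instance, no
`sorry`); books 0.  HC_CM is proved only modulo the printed citations until rung 0 closes.

## What is proved
* `fibrePointToLeft_one` (`A_s ∋ 1 ↦ s ≫ ε_A`), `valueAt_one` (**`λ̄(1) = ε_Â`** for a homomorphism `λ`, [MFK94] Def. 6.3
  «`S`-homomorphism»), `sliceAt_one` (the slice at `λ̄(1)` is the fibre inclusion followed by `A × {ε_Â}`);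
* `nonempty_tensorObj_dual_iso_unit` — **`L ⊗ L^∨ ≅ 𝒪`** for a line bundle (`[L ⊗ L^∨] = [L]·[L]⁻¹ = 1`);
* `nonempty_pullback_fst_unitHatSlice_iso_of_isLambdaOfAt` — on the fibre `A_s`: `𝒫|_{A_s × {ε_Â}} ≅ t_1^*𝒪(Θ) ⊗ 𝒪(Θ)^∨ ≅ 𝒪`
  ([MFK94] Def. 6.2 `Λ(L)` at the origin); over a FIELD, `nonempty_unitHatSlice_iso_of_isLambdaOfAt` (transported along
  `A ×_K K ≅ A`, ★ `isIso_pullback_fst_id`);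
* the polarised forms of the dual-transport theorems: `hat_isBaseChangeVia_id_hatTransport_of_isLambdaOfAt` (clause (ii)
  of [MFK94] Def. 7.3 along `𝟙 (Spec K)`) and `isMonHom_hatTransportOver_of_isLambdaOfAt`.

## References
* [MumfordFogartyKirwan1994] D. Mumford, J. Fogarty, F. Kirwan, *Geometric Invariant Theory*, 3rd ed. (1994), Ch. 6 §1
  Definition 6.1 (p. 115), §2 Definitions 6.2–6.3 (p. 120), Ch. 7 §2 Definition 7.3 (p. 130).
* [MilneAV2008] J. S. Milne, *Abelian Varieties* (v2.00, 2008), I §8 pp. 36–37, I Cor. 1.2 (p. 8).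
-/

set_option autoImplicit false

universe u

open CategoryTheory CategoryTheory.Limits AlgebraicGeometry MonoidalCategory

noncomputable section

namespace Literature.AlgebraicGeometry.AbelianSchemes

namespace AbelianSchemeOver

open Literature.AlgebraicGeometry.Motives Literature.AlgebraicGeometry.Modules
open Literature.AlgebraicGeometry.AbelianVarieties
open scoped MonObj

variable {S : Scheme.{u}} {A A' : AbelianSchemeOver S}

namespace DualPair

variable (D : A.DualPair) (D' : A'.DualPair) (e : A'.X ≅ A.X) [IsMonHom e.hom]

/-! ### §5 The unit hypothesis from a polarisation: `𝒫|_{A × {ε_Â}} ≅ 𝒪` when `λ` is a homomorphism with `λ̄ = Λ(𝒪(Θ))` -/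

/-- `L ⊗ L^∨ ≅ 𝒪` for a line bundle `L` (determinant classes: `[L ⊗ L^∨] = [L]·[L]⁻¹ = 1 = [𝒪]`, ★ `detClass_tensorObj_of_hasRank_one`,
★ `detClass_dual'`, ★ `nonempty_iso_unitModule_of_detClass_eq_one`). [cite: MilneAV2008, I §8 pp. 36–37] -/
theorem nonempty_tensorObj_dual_iso_unit {X : Scheme.{u}} {L : X.Modules} (hL : HasRank L 1) :
    Nonempty (tensorObj L (Modules.dual L) ≅ SheafOfModules.unit _) := by
  have hLd : HasRank (Modules.dual L) 1 := hasRank_dual hL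
  have hT : HasRank (tensorObj L (Modules.dual L)) 1 := hasRank_tensorObj_one hL hLd
  refine nonempty_iso_unitModule_of_detClass_eq_one hT (HasRank.isFiniteLocallyFree' hT) ?_
  rw [detClass_tensorObj_of_hasRank_one hL hLd (HasRank.isFiniteLocallyFree' hL) (HasRank.isFiniteLocallyFree' hLd) _,
    detClass_dual' (HasRank.isFiniteLocallyFree' hL), mul_inv_cancel]

section UnitPoint

variable {Ω : Type u} [Field Ω] (s : Spec (.of Ω) ⟶ S) (lam : A.X ⟶ D.hat.X)

omit [IsMonHom e.hom] in
/-- The point of `A` under the unit `Ω`-point of the fibre `A_s` is `s ≫ ε_A`. [cite: MumfordFogartyKirwan1994, Ch. 6 §1 Definition 6.1 (p. 115)] -/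
theorem fibrePointToLeft_one : A.fibrePointToLeft s (1 : (A.fibre s).toAbelianVariety.Points Ω) = s ≫ A.unitSection := by
  have h1 : (1 : (A.fibre s).toAbelianVariety.Points Ω) = A.restrictPt s 1 := (A.restrictPt_one s).symm
  rw [h1]
  refine (A.restrictPt_left_fst s 1).trans ?_
  change s ≫ (1 : A.Sections).left = s ≫ (η[A.X]).left
  rw [← MonObj.one_eq_one]

/-- **`λ̄(1) = ε_Â`** for a homomorphism `λ : A → Â` (`IsMonHom.one_hom`). [cite: MumfordFogartyKirwan1994, Ch. 6 §2 Definition 6.3 (p. 120)] -/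
theorem valueAt_one [IsMonHom lam] : A.valueAt s D lam 1 = s ≫ D.hat.unitSection := by
  change A.fibrePointToLeft s 1 ≫ lam.left = _
  rw [fibrePointToLeft_one, Category.assoc]
  exact congrArg (fun x => s ≫ Over.Hom.left x) (IsMonHom.one_hom lam)

/-- The slice at `λ̄(1)` is the fibre inclusion followed by `A × {ε_Â}`. [cite: MumfordFogartyKirwan1994, Ch. 6 §2 Definition 6.2 (p. 120)] -/
theorem sliceAt_one [IsMonHom lam] : A.sliceAt s D lam 1 = pullback.fst A.X.hom s ≫ unitHatSlice D := by
  have hcond : pullback.fst A.X.hom s ≫ A.X.hom = pullback.snd A.X.hom s ≫ s := pullback.condition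
  apply pullback.hom_ext
  · exact (A.sliceAt_fst s D lam 1).trans
      ((Category.comp_id _).symm.trans
        ((congrArg (fun x => pullback.fst A.X.hom s ≫ x) (unitHatSlice_fst D)).symm.trans (Category.assoc _ _ _).symm))
  · exact (A.sliceAt_snd s D lam 1).trans
      ((congrArg (fun x => pullback.snd A.X.hom s ≫ x) (valueAt_one D s lam)).trans
        ((Category.assoc _ _ _).symm.trans
          ((congrArg (fun x => x ≫ D.hat.unitSection) hcond.symm).trans
            ((Category.assoc _ _ _).trans
              ((congrArg (fun x => pullback.fst A.X.hom s ≫ x) (unitHatSlice_snd D)).symm.trans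
                (Category.assoc _ _ _).symm)))))

/-- **`𝒫|_{A_s × {ε_Â}} ≅ 𝒪` on the fibre `A_s`** from `λ̄ = Λ(𝒪(Θ))` at `s` for a homomorphism `λ`: the slice at
`λ̄(1) = ε_Â` is `t_1^*𝒪(Θ) ⊗ 𝒪(Θ)^∨ = 𝒪(Θ) ⊗ 𝒪(Θ)^∨ ≅ 𝒪`. [cite: MumfordFogartyKirwan1994, Ch. 6 §2 Definition 6.2 (p. 120)] [cite: MilneAV2008, I §8 pp. 36–37] -/
theorem nonempty_pullback_fst_unitHatSlice_iso_of_isLambdaOfAt [IsMonHom lam]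
    {Θ : CartierDivisor (A.fibre s).toAbelianVariety.X.left} (h : A.IsLambdaOfAt s D lam Θ) :
    Nonempty ((Scheme.Modules.pullback (pullback.fst A.X.hom s ≫ unitHatSlice D)).obj D.P ≅ SheafOfModules.unit _) := by
  obtain ⟨i⟩ := h 1
  obtain ⟨j⟩ := nonempty_tensorObj_dual_iso_unit (A.hasRank_lineBundleOfDivisor s Θ)
  have ht : ((A.fibre s).toAbelianVariety.translation 1).left = 𝟙 _ := by
    rw [AbelianVariety.translation_one]
    rfl
  exact ⟨(Scheme.Modules.pullbackCongr (sliceAt_one D s lam)).symm.app D.P ≪≫ i ≪≫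
    tensorMapIso ((Scheme.Modules.pullbackCongr ht).app _ ≪≫ (Scheme.Modules.pullbackId _).app _) (Iso.refl _) ≪≫ j⟩

end UnitPoint

/-- **THE UNIT HYPOTHESIS OF §4 FROM A POLARISATION (over a field)**: if `λ : A → Â` is a homomorphism with
`λ̄ = Λ(𝒪(Θ))` at the identity point, then `𝒫|_{A × {ε_Â}} ≅ 𝒪` — transported from the identity fibre `A ×_K K ≅ A`
(`pullback.fst _ (𝟙)` is an isomorphism, ★ `isIso_pullback_fst_id`). [cite: MumfordFogartyKirwan1994, Ch. 6 §2 Definitions 6.2–6.3 (p. 120)]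
[cite: MilneAV2008, I §8 pp. 36–37] -/
theorem nonempty_unitHatSlice_iso_of_isLambdaOfAt {K : Type u} [Field K] {A : AbelianSchemeOver (Spec (.of K))}
    (D : A.DualPair) (lam : A.X ⟶ D.hat.X) [IsMonHom lam]
    {Θ : CartierDivisor (A.fibre (𝟙 (Spec (.of K)))).toAbelianVariety.X.left}
    (h : A.IsLambdaOfAt (𝟙 (Spec (.of K))) D lam Θ) :
    Nonempty ((Scheme.Modules.pullback (unitHatSlice D)).obj D.P ≅ SheafOfModules.unit _) := by
  obtain ⟨k⟩ := nonempty_pullback_fst_unitHatSlice_iso_of_isLambdaOfAt D (𝟙 (Spec (.of K))) lam h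
  haveI := isIso_pullback_fst_id A.X
  have hg : inv (pullback.fst A.X.hom (𝟙 (Spec (.of K)))) ≫ (pullback.fst A.X.hom (𝟙 (Spec (.of K))) ≫ unitHatSlice D) =
      unitHatSlice D := by
    rw [IsIso.inv_hom_id_assoc]
  have hI : IsIso (SheafOfModules.pullbackObjUnitToUnit (inv (pullback.fst A.X.hom (𝟙 (Spec (.of K))))).toRingCatSheafHom) := by
    haveI := Literature.AlgebraicGeometry.KTheory.final_opensMap (inv (pullback.fst A.X.hom (𝟙 (Spec (.of K)))))
    exact SheafOfModules.instIsIsoPullbackObjUnitToUnitOfFinal _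
  exact ⟨((Scheme.Modules.pullbackCongr hg).app D.P).symm ≪≫ ((Scheme.Modules.pullbackComp _ _).app D.P).symm ≪≫
    (Scheme.Modules.pullback _).mapIso k ≪≫
    @asIso _ _ _ _ (SheafOfModules.pullbackObjUnitToUnit (inv (pullback.fst A.X.hom (𝟙 (Spec (.of K))))).toRingCatSheafHom) hI⟩

end DualPair

/-! #### Over a field `K`: the polarised forms of clause (ii) -/

namespace DualPair

variable {K : Type u} [Field K] {A A' : AbelianSchemeOver (Spec (.of K))} (D : A.DualPair) (D' : A'.DualPair)
  (e : A'.X ≅ A.X) [IsMonHom e.hom]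

/-- **Clause (ii) for POLARISED abelian schemes over a field** — the unit hypotheses discharged by homomorphisms
`λ : A → Â`, `λ' : A' → Â'` with `λ̄ = Λ(𝒪(Θ))`, `λ̄' = Λ(𝒪(Θ'))` at the identity point (§5).
[cite: MumfordFogartyKirwan1994, Ch. 7 §2 Definition 7.3 (p. 130) and Ch. 6 §2 Definitions 6.2–6.3 (p. 120)] -/
theorem hat_isBaseChangeVia_id_hatTransport_of_isLambdaOfAt (e' : A.X ≅ A'.X) [IsMonHom e'.hom] (he' : e'.hom = e.inv)
    (lam : A.X ⟶ D.hat.X) [IsMonHom lam] {Θ : CartierDivisor (A.fibre (𝟙 (Spec (.of K)))).toAbelianVariety.X.left}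
    (hΘ : A.IsLambdaOfAt (𝟙 (Spec (.of K))) D lam Θ)
    (lam' : A'.X ⟶ D'.hat.X) [IsMonHom lam'] {Θ' : CartierDivisor (A'.fibre (𝟙 (Spec (.of K)))).toAbelianVariety.X.left}
    (hΘ' : A'.IsLambdaOfAt (𝟙 (Spec (.of K))) D' lam' Θ') :
    D'.hat.IsBaseChangeVia D.hat (𝟙 (Spec (.of K))) (hatTransport D D' e) :=
  hat_isBaseChangeVia_id_hatTransport D D' e e' he' (nonempty_unitHatSlice_iso_of_isLambdaOfAt D lam hΘ)
    (nonempty_unitHatSlice_iso_of_isLambdaOfAt D' lam' hΘ')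

/-- `Ĥ_e` is a homomorphism, for POLARISED abelian schemes over a field (unit hypotheses from §5).
[cite: MilneAV2008, I Cor. 1.2 (p. 8) and §8 pp. 36–37] -/
theorem isMonHom_hatTransportOver_of_isLambdaOfAt
    (lam : A.X ⟶ D.hat.X) [IsMonHom lam] {Θ : CartierDivisor (A.fibre (𝟙 (Spec (.of K)))).toAbelianVariety.X.left}
    (hΘ : A.IsLambdaOfAt (𝟙 (Spec (.of K))) D lam Θ)
    (lam' : A'.X ⟶ D'.hat.X) [IsMonHom lam'] {Θ' : CartierDivisor (A'.fibre (𝟙 (Spec (.of K)))).toAbelianVariety.X.left}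
    (hΘ' : A'.IsLambdaOfAt (𝟙 (Spec (.of K))) D' lam' Θ') :
    IsMonHom (hatTransportOver D D' e) :=
  isMonHom_hatTransportOver D D' e (nonempty_unitHatSlice_iso_of_isLambdaOfAt D lam hΘ)
    (nonempty_unitHatSlice_iso_of_isLambdaOfAt D' lam' hΘ')

end DualPair

end AbelianSchemeOver

end Literature.AlgebraicGeometry.AbelianSchemes

end
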